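import Summits.BirchSwinnertonDyer.Rank1Residual.Additive.X4RankZeroUpperHalfOfShaDvd
import Summits.BirchSwinnertonDyer.Rank1Residual.Additive.GordRankZeroKatoComponentTower
import Summits.BirchSwinnertonDyer.Rank1Residual.Additive.X4MThreeUpperHalfTowerFree
import HarnessLib

/-!
# X4 / X4♯(G-ord) rank `0` at `p ≡ 3 (mod 4)`: the UPPER half on a control input asked ONLY at the
# cyclotomic-variable generator (cell `b2b-bsdres`, team n1011, ROW T-DEL98X, seat p10 GEN 10, FILE 2a —
# the socket the Delbourgo-2002 supplier of FILE 2b plugs into)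

HONEST FRAMING (cell `b2b-bsdres`, run/shared/lean/b2b/bsd-rank1-residual/, verbatim in every
file): the goal of the cell is to DELETE the COMBINATION-SHAPED residual classes of the
Birch–Swinnerton-Dyer formula for ALL analytic-rank `≤ 1` elliptic curves over `ℚ` — "full BSD
formula for every rank `≤ 1` curve in class `C`" assembled STRICTLY from published theorems — so
that the rank-`≤ 1` remainder becomes exactly the CONSTRUCTION-SHAPED classes, which are TYPED
(missing-input `Prop`s), NOT attempted. This is not "finishing BSD". Team n1011 (N10 / N11, the
additive block `X4 ∧ p = 3`): research route; TOOL + ASSEMBLY theorems only — no definition, no named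
fact, no `sorry`; nothing booked; no residual-map mark / label / count moved; X4♯(G-ord) stays
CONSTRUCTION-SHAPED. NOTHING of additive-p4's / p06's / p14's is edited: §1 is a NEW declaration whose
proof body is p06's `AdditiveTwistOdd.shaOrder_le_of_leadingTerm_of_shaDvd` (T-CTL-UP FILE 3a, itself
additive-p4's V9 core) token for token except at the ONE line [A].

## What and why

p06's FILE 3a abstracts the single use of `Delbourgo1998.prop4_rankZero_pow_dvd_constantCoeff` (A75)
in the rank-`0` upper-half assemblies as a pointwise supplier `hdivAt`, quantified over EVERY
topological generator `γ` of `Gal(ℚ_∞/ℚ)`. The assemblies USE it only at the generator `γ` matching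
the cyclotomic variable (`IsCyclotomicVariable p γ`), which they choose themselves
(`exists_isCyclotomic_isTopGenerator_isCyclotomicVariable_holds`). A supplier coming from an EXACT
`p`-adic BSD leading-term formula — Delbourgo 2002 Theorem (B), tree `Delbourgo2002.LeadingTermClauses`,
stated for the cyclotomic-variable generator because its `log_p(γ_cyc)^r` factor is — can only answer
at such `γ`. This file re-runs the odd chain on the WEAKER supplier shape `hdivCyc` (= `hdivAt` with
the extra premise `IsCyclotomicVariable p γ`):

* §1 `AdditiveTwistOdd.shaOrder_le_of_leadingTerm_of_shaDvdCyc` — the class-agnostic odd core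
  (`p ≡ 3 (mod 4)`): `#Ш_an = q` with `ord_p #Ш ≤ ord_p q + ord_p c_p`.
* §2 `X4RankZeroTwistOdd.shaOrder_le_of_shaDvdCyc` / `…missingUpperBoundAt_of_shaDvdCyc` — the X4 odd
  twist level (additive-p4's `X4RankZeroTwistOdd.shaOrder_le` / `…missingUpperBoundAt` with `hDel ↦ hdivCyc`).
* §3 `ClassX4Gord.missingUpperBoundAt_three_of_{chiBranch,katoComponent}_of_surj_of_shaDvdCyc`,
  `ClassX4Gord.bsdp_three_of_katoComponent_of_surj_of_lower_of_shaDvdCyc` — X4♯(G-ord) at `p = 3`,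
  `r_an = 0`, surj(3): the UPPER half and `BSD(E,3)` from the lower half on the supplier + Kato's
  component divisibility `hK` + GZK + modularity (n1011-p14's certificate-free route of
  `ClassX4Gord.missingUpperBoundAt_three_of_katoComponent_of_surj`; `c₃(E) ∈ {1,2,4}` on `I₀*`).
Every `hdivAt` supplier is an `hdivCyc` supplier (forget the premise), so nothing is lost. FILE 2b
(`Additive/GordRankZeroUpperHalfOfExactLeadingTerm`) supplies `hdivCyc` at `3` on X4♯(G-ord) ∧ non-CM ∧
`r_an = 0` from `Delbourgo2002.mainTheorem_three` and re-keys route 2's Gord END of record with `hDel98`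
OUT. Axioms standard.

References: [Delbourgo1998] Prop. 4 (p. 144) (shape only); [Delbourgo2002] Theorem (B) (p. 40);
[Kato2004Asterisque] Thm. 17.4 (3) (p. 273); [MazurTateTeitelbaum1986Invent] §I.13;
[Miller2011LMS] Def. 1.1; cells/n1011/INBOX.md 2026-08-22T07:53Z (names line), lead R5-106 (t).
-/

noncomputable section

open scoped Classical MatrixGroups ModularForm

open CongruenceSubgroup WeierstrassCurve Literature.NumberTheory.EllipticCurves
  Literature.NumberTheory.EllipticCurves.ModularForms
  Literature.NumberTheory.EllipticCurves.Rank1Residual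

namespace Summit.BirchSwinnertonDyer.Rank1Residual.Additive

/-! ### §1 The class-agnostic odd core on the cyclotomic-generator supplier -/

section Core

open IsDedekindDomain NumberField Rat.HeightOneSpectrum
  Literature.NumberTheory.EllipticCurves.Rank1Residual.Typed

variable (W : WeierstrassCurve ℚ) [W.IsElliptic] [W.IsGloballyMinimal] (p : ℕ) [hp : Fact p.Prime]

/-- **Class-agnostic odd core (rank `0`, `p ≡ 3 (mod 4)`) with the control input asked ONLY at the
cyclotomic-variable generator.** n1011-p06's `AdditiveTwistOdd.shaOrder_le_of_leadingTerm_of_shaDvd`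
(T-CTL-UP FILE 3a; = additive-p4's `AdditiveTwistOdd.shaOrder_le_of_leadingTerm`, line V9, with the
named fact A75 abstracted) token for token, except that the pointwise supplier `hdivCyc` of
`p ^ (ord_p #Ш[p^∞] + ord_p ∏ᶠ_{v∤p} c_v) ∣ g(0) · #E(ℚ)²` carries the extra premise
`IsCyclotomicVariable p γ` — which the core has in hand at its one use [A]. For `W = C • V^{(−p)}`,
`ord_p u(C) = 0`, `f` the newform of `V`, `ϖ⁻·|Ω⁻(V)| = Ω⁻_f`: `hdivCyc` + `hLT` + odd Birch + Pal
(`d < 0`) + Kodaira–Néron + GZK + modularity ⇒ `#Ш_an(E) = q ∈ ℚ` with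
**`ord_p #Ш(E) ≤ ord_p q + ord_p c_p(E)`**. [cite: Delbourgo1998, Prop. 4 (p. 144) (shape of the abstracted input only)]
[cite: MazurTateTeitelbaum1986Invent, §I.13 (the cyclotomic variable)] [cite: Miller2011LMS, Def. 1.1] -/
theorem AdditiveTwistOdd.shaOrder_le_of_leadingTerm_of_shaDvdCyc
    (hdivCyc : ∀ (κ : ZpExtension ℚ p) (γ : Field.absoluteGaloisGroup ℚ), κ.IsCyclotomic →
      κ.IsTopGenerator γ → IsCyclotomicVariable p γ →
      ∀ D : W.SelmerDualData κ γ, Finite W.sha → Finite W.toAffine.Point →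
      ∀ g ∈ D.charIdeal,
        (p : ℤ_[p]) ^ (padicValNat p (Nat.card (AddCommGroup.primaryComponent W.sha p)) +
            padicValNat p (∏ᶠ v : HeightOneSpectrum (𝓞 ℚ),
              if (p : 𝓞 ℚ) ∈ v.asIdeal then 1 else W.tamagawaNumberAt v)) ∣
          PowerSeries.constantCoeff g * ((Nat.card W.toAffine.Point : ℕ) : ℤ_[p]) ^ 2)
    (hGZK : rank_eq_analyticRank_of_analyticRank_le_one) (hmod : hasEntireLFunction_rat)
    (hp4 : p % 4 = 3) (hr : W.analyticRank = 0) (hadd : Addv W p)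
    (V : WeierstrassCurve ℚ) [V.IsElliptic] [V.IsGloballyMinimal]
    (C : VariableChange ℚ) (hC : C • V.quadraticTwist (-(p : ℚ)) = W)
    (hu : padicValRat p (C.u : ℚ) = 0)
    {N : ℕ} [NeZero N] {f : CuspForm (Gamma0 N) 2} (hf : IsNewformOf V f)
    (ϖ : ℚ) (hϖ : (ϖ : ℝ) * V.imaginaryPeriodRat = minusPeriod f)
    (hLT : ∀ (κ : ZpExtension ℚ p) (γ : Field.absoluteGaloisGroup ℚ),
      κ.IsCyclotomic → κ.IsTopGenerator γ → IsCyclotomicVariable p γ →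
      ∀ D : W.SelmerDualData κ γ, ∃ g ∈ D.charIdeal, ∃ u : ℤ_[p]ˣ,
        ((PowerSeries.constantCoeff g : ℤ_[p]) : ℚ_[p]) =
          ((u : ℤ_[p]) : ℚ_[p]) * (ϖ : ℚ_[p]) * (legendreMinusSymbolSum f p : ℚ_[p])) :
    ∃ q : ℚ, shaAn W = (q : ℂ) ∧
      (padicValNat p W.shaOrder : ℤ) ≤
        padicValRat p q + padicValNat p (W.tamagawaNumberAt ((primesEquiv (R := 𝓞 ℚ)).symm ⟨p, hp.out⟩)) := by
  classical
  have hpP : p.Prime := hp.out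
  have hp2 : p ≠ 2 := by omega
  set v₀ : HeightOneSpectrum (𝓞 ℚ) := (primesEquiv (R := 𝓞 ℚ)).symm ⟨p, hp.out⟩ with hv₀
  -- rank 0: `L(E,1) ≠ 0`, `E(ℚ)` and `Ш` finite
  have hL : W.entireLFunction 1 ≠ 0 := (W.analyticRank_eq_zero_iff_holds (hmod W)).mp hr
  obtain ⟨hmw, hfin⟩ := hGZK W (by rw [hr]; exact zero_le_one)
  have hmw0 : W.mordellWeilRank = 0 := by rw [hmw, hr]
  haveI : Finite W.sha := hfin
  haveI hE : Finite W.toAffine.Point := W.finite_point_of_rank_zero hmw0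
  -- the cyclotomic setting and `X(E/ℚ_∞)`
  obtain ⟨κ, hκ, γ, hγ, hγ'⟩ := exists_isCyclotomic_isTopGenerator_isCyclotomicVariable_holds p
  obtain ⟨D⟩ := W.nonempty_selmerDualData_holds κ γ hγ
  -- [B∘C](0), odd branch
  obtain ⟨g, hgmem, u, hg0⟩ := hLT κ γ hκ hγ hγ' D
  -- [A]: the UPPER half of control at this pair (abstract supplier `hdivCyc`, asked at the
  -- cyclotomic-variable generator only)
  have hdvd := hdivCyc κ γ hκ hγ hγ' D hfin hE g hgmem
  -- [E⁻] + [F] + odd Birch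
  obtain ⟨ε, hε, hLq⟩ := entireLFunction_one_eq_of_twist_neg p hmod hp4 V W C hC hadd hf ϖ hϖ
  set S : ℚ := legendreMinusSymbolSum f p with hS
  set cinf : ℕ := (W.baseChange ℝ).numRealComponents with hcinf
  set q : ℚ := ε * (ϖ * S) / (|(C.u : ℚ)| * (cinf : ℚ)) with hq
  have hΩ : (W.realPeriodRat : ℂ) ≠ 0 := by exact_mod_cast W.realPeriodRat_pos_holds.ne'
  have hq' : W.entireLFunction 1 / (W.realPeriodRat : ℂ) = (q : ℂ) := by
    rw [hLq, mul_div_cancel_right₀ _ hΩ]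
  obtain ⟨-, -, -, hshaAn⟩ := Wuthrich2014.shaAn_eq_of_L_one_div_eq hGZK W hL hq'
  -- non-vanishing and the valuation of `q`
  have hua0 : |(C.u : ℚ)| ≠ 0 := abs_ne_zero.mpr C.u.ne_zero
  have hcinf0 : (cinf : ℚ) ≠ 0 := by
    rw [hcinf, numRealComponents]
    split_ifs <;> norm_num
  have hden0 : |(C.u : ℚ)| * (cinf : ℚ) ≠ 0 := mul_ne_zero hua0 hcinf0
  have hϖS : ϖ * S ≠ 0 := by
    intro h0
    apply hL
    rw [hLq, hq, h0, mul_zero, zero_div, Rat.cast_zero, zero_mul]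
  have hε0 : ε ≠ 0 := by rcases hε with h | h <;> rw [h] <;> norm_num
  have hq0 : q ≠ 0 := by
    rw [hq]
    exact div_ne_zero (mul_ne_zero hε0 hϖS) hden0
  have hvε : padicValRat p ε = 0 := by
    rcases hε with h | h
    · rw [h, padicValRat.one]
    · rw [h, padicValRat.neg, padicValRat.one]
  have hvua : padicValRat p |(C.u : ℚ)| = 0 := by
    rcases abs_choice (C.u : ℚ) with h | h
    · rw [h, hu]
    · rw [h, padicValRat.neg, hu]
  have hvq : padicValRat p q = padicValRat p (ϖ * S) := by
    rw [hq, padicValRat.div (mul_ne_zero hε0 hϖS) hden0, padicValRat.mul hε0 hϖS,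
      padicValRat.mul hua0 hcinf0, hvε, hvua, padicValRat_numRealComponents_eq_zero W p hp2]
    ring
  -- names for the arithmetic quantities
  set T : ℕ := Nat.card W.toAffine.Point with hT
  set c : ℕ := W.tamagawaNumberAt v₀ with hc
  set P' : ℕ := ∏ᶠ v : HeightOneSpectrum (𝓞 ℚ),
    (if (p : 𝓞 ℚ) ∈ v.asIdeal then 1 else W.tamagawaNumberAt v) with hP'
  have hT0 : T ≠ 0 := by rw [hT]; exact Nat.card_pos.ne'
  have hPsplit : W.tamagawaProduct = c * P' := tamagawaProduct_eq_tamagawaNumberAt_mul_finprod W p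
  have hPpos : 0 < W.tamagawaProduct := W.tamagawaProduct_pos_holds
  have hc0 : c ≠ 0 := fun h ↦ by rw [hPsplit, h, zero_mul] at hPpos; exact lt_irrefl 0 hPpos
  have hP'0 : P' ≠ 0 := fun h ↦ by rw [hPsplit, h, mul_zero] at hPpos; exact lt_irrefl 0 hPpos
  have hvP : padicValNat p W.tamagawaProduct = padicValNat p c + padicValNat p P' := by
    rw [hPsplit, padicValNat.mul hc0 hP'0]
  have hsha : padicValNat p (Nat.card (AddCommGroup.primaryComponent W.sha p)) =
      padicValNat p W.shaOrder := by
    unfold WeierstrassCurve.shaOrder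
    exact padicValNat_card_addPrimaryComponent p
  -- the divisibility in `ℤ_p`, read as an inequality of valuations in `ℚ_p`
  set g0 : ℚ_[p] := ((PowerSeries.constantCoeff g : ℤ_[p]) : ℚ_[p]) with hg0def
  have hg0S : g0 = ((u : ℤ_[p]) : ℚ_[p]) * ((ϖ * S : ℚ) : ℚ_[p]) := by
    rw [hg0]
    push_cast
    ring
  have hϖSQ : ((ϖ * S : ℚ) : ℚ_[p]) ≠ 0 := by exact_mod_cast hϖS
  have hg0ne : g0 ≠ 0 := by
    rw [hg0S]
    exact mul_ne_zero (coe_units_ne_zero p u) hϖSQ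
  have hvg0 : g0.valuation = padicValRat p (ϖ * S) := by
    rw [hg0S, Padic.valuation_mul (coe_units_ne_zero p u) hϖSQ, valuation_coe_units_eq_zero,
      zero_add, Padic.valuation_ratCast]
  have hTQ : ((T : ℕ) : ℚ_[p]) ≠ 0 := by exact_mod_cast hT0
  obtain ⟨c', hc'⟩ := hdvd
  have hkey : g0 * ((T : ℕ) : ℚ_[p]) ^ 2 =
      (p : ℚ_[p]) ^ (padicValNat p (Nat.card (AddCommGroup.primaryComponent W.sha p)) +
        padicValNat p P') * ((c' : ℤ_[p]) : ℚ_[p]) := by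
    have h := congrArg ((↑) : ℤ_[p] → ℚ_[p]) hc'
    push_cast at h
    rw [hg0def]
    exact h
  have hlhs0 : g0 * ((T : ℕ) : ℚ_[p]) ^ 2 ≠ 0 := mul_ne_zero hg0ne (pow_ne_zero 2 hTQ)
  have hc'0 : ((c' : ℤ_[p]) : ℚ_[p]) ≠ 0 := by
    intro h0
    rw [h0, mul_zero] at hkey
    exact hlhs0 hkey
  have hpQ : (p : ℚ_[p]) ≠ 0 := by exact_mod_cast hpP.ne_zero
  have hval := congrArg Padic.valuation hkey
  rw [Padic.valuation_mul hg0ne (pow_ne_zero 2 hTQ), Padic.valuation_pow, Padic.valuation_natCast,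
    hvg0, Padic.valuation_mul (pow_ne_zero _ hpQ) hc'0, Padic.valuation_pow, Padic.valuation_p,
    mul_one, hsha] at hval
  have hc'val : 0 ≤ (((c' : ℤ_[p]) : ℚ_[p])).valuation := PadicInt.valuation_coe_nonneg
  have hineq : (padicValNat p W.shaOrder : ℤ) + padicValNat p P' ≤
      padicValRat p (ϖ * S) + 2 * (padicValNat p T : ℤ) := by
    simp only [Nat.cast_add, Nat.cast_ofNat] at hval
    linarith
  -- conclusion
  refine ⟨q * (T : ℚ) ^ 2 / (W.tamagawaProduct : ℚ), ?_, ?_⟩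
  · rw [hshaAn]
  · have hTq : (T : ℚ) ≠ 0 := by exact_mod_cast hT0
    have hPq : (W.tamagawaProduct : ℚ) ≠ 0 := by exact_mod_cast hPpos.ne'
    rw [padicValRat.div (mul_ne_zero hq0 (pow_ne_zero 2 hTq)) hPq,
      padicValRat.mul hq0 (pow_ne_zero 2 hTq), padicValRat.pow, padicValRat.of_nat,
      padicValRat.of_nat, hvq, hvP]
    simp only [Nat.cast_ofNat, Nat.cast_add]
    linarith

/-! ### §2 X4, `p ≡ 3 (mod 4)`: additive-p4's odd twist level on the cyclotomic-generator supplier -/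

/-- **X4 ∧ `r_an = 0`, `p ≡ 3 (mod 4)`, semistable twist `W = C • V^{(−p)}` with `ρ̄_{V,pⁿ}` onto,
granted `ChiBranchLeadingTermOddBigImageAt W p`: `#Ш_an(E) = q` with
`ord_p #Ш(E) ≤ ord_p q + ord_p c_p(E)`** — additive-p4's `X4RankZeroTwistOdd.shaOrder_le` with
`hDel ↦ hdivCyc` over the core of §1. [cite: Kato2004Asterisque, Thm. 17.4 (3) (p. 273)]
[cite: Delbourgo1998, Prop. 4 (p. 144) (shape of the abstracted input only)] [cite: Miller2011LMS, Def. 1.1] -/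
theorem X4RankZeroTwistOdd.shaOrder_le_of_shaDvdCyc
    (hdivCyc : ∀ (κ : ZpExtension ℚ p) (γ : Field.absoluteGaloisGroup ℚ), κ.IsCyclotomic →
      κ.IsTopGenerator γ → IsCyclotomicVariable p γ →
      ∀ D : W.SelmerDualData κ γ, Finite W.sha → Finite W.toAffine.Point →
      ∀ g ∈ D.charIdeal,
        (p : ℤ_[p]) ^ (padicValNat p (Nat.card (AddCommGroup.primaryComponent W.sha p)) +
            padicValNat p (∏ᶠ v : HeightOneSpectrum (𝓞 ℚ),
              if (p : 𝓞 ℚ) ∈ v.asIdeal then 1 else W.tamagawaNumberAt v)) ∣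
          PowerSeries.constantCoeff g * ((Nat.card W.toAffine.Point : ℕ) : ℤ_[p]) ^ 2)
    (hGZK : rank_eq_analyticRank_of_analyticRank_le_one) (hmod : hasEntireLFunction_rat)
    (hBC : ChiBranchLeadingTermOddBigImageAt W p)
    (hp4 : p % 4 = 3) (hr : W.analyticRank = 0) (hX : ClassX4 W p)
    (V : WeierstrassCurve ℚ) [V.IsElliptic] [V.IsGloballyMinimal]
    (C : VariableChange ℚ) (hC : C • V.quadraticTwist (-(p : ℚ)) = W) (hV : GoodOrd V p ∨ Mult V p)
    (hsurj : ∀ n : ℕ, V.HasSurjectiveModNGaloisRep (p ^ n : ℕ))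
    {N : ℕ} [NeZero N] {f : CuspForm (Gamma0 N) 2} (hf : IsNewformOf V f)
    (ϖ : ℚ) (hϖ : (ϖ : ℝ) * V.imaginaryPeriodRat = minusPeriod f) :
    ∃ q : ℚ, shaAn W = (q : ℂ) ∧
      (padicValNat p W.shaOrder : ℤ) ≤
        padicValRat p q + padicValNat p (W.tamagawaNumberAt ((primesEquiv (R := 𝓞 ℚ)).symm ⟨p, hp.out⟩)) := by
  have hp2 : p ≠ 2 := by omega
  have hC' : C • V.quadraticTwist (((-(p : ℤ)) : ℤ) : ℚ) = W := by push_cast; exact hC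
  have hu : padicValRat p (C.u : ℚ) = 0 :=
    padicValRat_u_eq_zero_of_twist_pm_p p hp2 V W (hV.elim (fun h ↦ Or.inl h.1) Or.inr)
      (Or.inr rfl) C hC'
  exact AdditiveTwistOdd.shaOrder_le_of_leadingTerm_of_shaDvdCyc W p hdivCyc hGZK hmod hp4 hr hX.2.1 V
    C hC hu hf ϖ hϖ fun _ _ hκ hγ hγ' D ↦ (hBC V hp4 ⟨C, hC⟩ hV hsurj hκ hγ hγ' hf D ϖ hϖ).2

/-- **The typed UPPER half `ord_p #Ш(E) ≤ ord_p #Ш_an(E)` on X4 at `p ≡ 3 (mod 4)` whenever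
`p ∤ c_p(E)`, granted the typed Kato-branch input, on the cyclotomic-generator supplier** —
additive-p4's `X4RankZeroTwistOdd.missingUpperBoundAt` with `hDel ↦ hdivCyc`.
[cite: Kato2004Asterisque, Thm. 17.4 (3) (p. 273)] [cite: Delbourgo1998, Prop. 4 (p. 144) (shape of the abstracted input only)]
[cite: Miller2011LMS, Def. 1.1] -/
theorem X4RankZeroTwistOdd.missingUpperBoundAt_of_shaDvdCyc
    (hdivCyc : ∀ (κ : ZpExtension ℚ p) (γ : Field.absoluteGaloisGroup ℚ), κ.IsCyclotomic →
      κ.IsTopGenerator γ → IsCyclotomicVariable p γ →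
      ∀ D : W.SelmerDualData κ γ, Finite W.sha → Finite W.toAffine.Point →
      ∀ g ∈ D.charIdeal,
        (p : ℤ_[p]) ^ (padicValNat p (Nat.card (AddCommGroup.primaryComponent W.sha p)) +
            padicValNat p (∏ᶠ v : HeightOneSpectrum (𝓞 ℚ),
              if (p : 𝓞 ℚ) ∈ v.asIdeal then 1 else W.tamagawaNumberAt v)) ∣
          PowerSeries.constantCoeff g * ((Nat.card W.toAffine.Point : ℕ) : ℤ_[p]) ^ 2)
    (hGZK : rank_eq_analyticRank_of_analyticRank_le_one) (hmod : hasEntireLFunction_rat)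
    (hBC : ChiBranchLeadingTermOddBigImageAt W p)
    (hp4 : p % 4 = 3) (hr : W.analyticRank = 0) (hX : ClassX4 W p)
    (V : WeierstrassCurve ℚ) [V.IsElliptic] [V.IsGloballyMinimal]
    (C : VariableChange ℚ) (hC : C • V.quadraticTwist (-(p : ℚ)) = W) (hV : GoodOrd V p ∨ Mult V p)
    (hsurj : ∀ n : ℕ, V.HasSurjectiveModNGaloisRep (p ^ n : ℕ))
    {N : ℕ} [NeZero N] {f : CuspForm (Gamma0 N) 2} (hf : IsNewformOf V f)
    (ϖ : ℚ) (hϖ : (ϖ : ℝ) * V.imaginaryPeriodRat = minusPeriod f)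
    (htam : ¬ p ∣ W.tamagawaNumberAt ((primesEquiv (R := 𝓞 ℚ)).symm ⟨p, hp.out⟩)) :
    MissingUpperBoundAt W p := by
  obtain ⟨q, hq, hle⟩ := X4RankZeroTwistOdd.shaOrder_le_of_shaDvdCyc W p hdivCyc hGZK hmod hBC hp4 hr
    hX V C hC hV hsurj hf ϖ hϖ
  refine ⟨q, hq, ?_⟩
  rw [padicValNat.eq_zero_of_not_dvd htam, Nat.cast_zero, add_zero] at hle
  exact hle

end Core

/-! ### §3 X4♯(G-ord) at `p = 3`, rank `0`, surj(3): the upper half and `BSD(E,3)` on the supplier -/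

section Gord

open IsDedekindDomain NumberField Rat.HeightOneSpectrum
  Literature.NumberTheory.EllipticCurves.Rank1Residual.Typed

variable {W : WeierstrassCurve ℚ} [W.IsElliptic] [W.IsGloballyMinimal]

/-- **X4♯(G-ord) ∧ `p = 3` ∧ `r_an = 0` ∧ surj(3), on the cyclotomic-generator supplier:
`Typed.MissingUpperBoundAt W 3` from the typed odd-branch input `ChiBranchLeadingTermOddBigImageAt W 3`**
— n1011-p14's certificate-free route (`ClassX4Gord.missingUpperBoundAt_three_of_katoComponent_of_surj`
over additive-p2's V24 `…_of_towerSurj`) with `hDel ↦ hdivCyc`: good ordinary twist model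
`C • V^{(−3)} = W` (`ClassX4Gord.exists_goodOrd_pStar_twist_model`, defect `e = 2` automatic at `3`),
the tower of `E` from surj(3) (`ClassX4Gord.towerSurj_of_surj`) transported to `V`
(`GaloisImage.hasSurjectiveModNGaloisRep_pow_iff_of_model_twist`), newform / `Ω⁻` ratio from `hmodD`,
`3 ∤ c₃(E)` on `I₀*` (`not_dvd_tamagawaNumberAt_twist_pm_p`). NO (ram), NO Tamagawa, NO Manin
binder. [cite: Kato2004Asterisque, Thm. 17.4 (3) (p. 273)]
[cite: Delbourgo1998, Prop. 4 (p. 144) (shape of the abstracted input only)] [cite: Miller2011LMS, Def. 1.1] -/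
theorem ClassX4Gord.missingUpperBoundAt_three_of_chiBranch_of_surj_of_shaDvdCyc [Fact (Nat.Prime 3)]
    (hdivCyc : ∀ (κ : ZpExtension ℚ 3) (γ : Field.absoluteGaloisGroup ℚ), κ.IsCyclotomic →
      κ.IsTopGenerator γ → IsCyclotomicVariable 3 γ →
      ∀ D : W.SelmerDualData κ γ, Finite W.sha → Finite W.toAffine.Point →
      ∀ g ∈ D.charIdeal,
        (3 : ℤ_[3]) ^ (padicValNat 3 (Nat.card (AddCommGroup.primaryComponent W.sha 3)) +
            padicValNat 3 (∏ᶠ v : HeightOneSpectrum (𝓞 ℚ),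
              if ((3 : ℕ) : 𝓞 ℚ) ∈ v.asIdeal then 1 else W.tamagawaNumberAt v)) ∣
          PowerSeries.constantCoeff g * ((Nat.card W.toAffine.Point : ℕ) : ℤ_[3]) ^ 2)
    (hGZK : rank_eq_analyticRank_of_analyticRank_le_one) (hmod : hasEntireLFunction_rat)
    (hmodD : nonempty_modularParametrizationData)
    (hBCodd : ChiBranchLeadingTermOddBigImageAt W 3)
    (hX : ClassX4Gord W 3) (hr : W.analyticRank = 0) (hsurj : Surj W 3) :
    MissingUpperBoundAt W 3 := by
  have he : semistabilityIndex W 3 = 2 :=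
    semistabilityIndex_eq_two_of_typeG_three W hX.typeGOrd.typeG hX.addv.2
  obtain ⟨V, iV, iVm, C, hV, hC⟩ := hX.exists_goodOrd_pStar_twist_model W 3 he
  haveI : NeZero (V.conductorNorm ℤ) := ⟨(V.conductorNorm_pos_holds).ne'⟩
  obtain ⟨Dm⟩ := hmodD V
  obtain ⟨ϖ', -, hϖ'⟩ := exists_rat_mul_imaginaryPeriodRat_eq_minusPeriod Dm
  have hC' : C • V.quadraticTwist (-((3 : ℕ) : ℚ)) = W := by
    rw [pStar_eq_of_mod_four 3 (Or.inr rfl), if_neg (by omega)] at hC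
    exact hC
  have hpne : (-((3 : ℕ) : ℚ)) ≠ 0 := by norm_num
  have htowerV : ∀ n : ℕ, V.HasSurjectiveModNGaloisRep (3 ^ n : ℕ) := fun n ↦
    (GaloisImage.hasSurjectiveModNGaloisRep_pow_iff_of_model_twist V 3 hpne ⟨C, hC'⟩ n).mp
      (ClassX4Gord.towerSurj_of_surj hX he hsurj n)
  have htam := not_dvd_tamagawaNumberAt_twist_pm_p 3 (by norm_num) V (Or.inl hV.1)
    (d := -((3 : ℕ) : ℚ)) (Or.inr rfl) C hC'
  exact X4RankZeroTwistOdd.missingUpperBoundAt_of_shaDvdCyc W 3 hdivCyc hGZK hmod hBCodd rfl hr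
    hX.classX4 V C hC' (Or.inl hV) htowerV Dm.isNewformOf ϖ' hϖ' htam

/-- **X4♯(G-ord) ∧ `p = 3` ∧ `r_an = 0` ∧ surj(3), on the cyclotomic-generator supplier: the UPPER
half `ord₃ #Ш(E) ≤ ord₃ #Ш_an(E)`** with the branch input DISCHARGED by Kato's component divisibility
(`chiBranchLeadingTermOddBigImageAt_of_katoComponent`, `ord₃ j(E) ≥ 0` on the (G)-cell) — the tree's
`ClassX4Gord.missingUpperBoundAt_three_of_katoComponent_of_surj` with `hDel ↦ hdivCyc`; named facts
{hK, hGZK, hmod, hmodD} + the supplier. [cite: Kato2004Asterisque, Thm. 17.4 (3) (p. 273)]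
[cite: Delbourgo1998, Prop. 4 (p. 144) (shape of the abstracted input only)] [cite: Miller2011LMS, Def. 1.1] -/
theorem ClassX4Gord.missingUpperBoundAt_three_of_katoComponent_of_surj_of_shaDvdCyc [Fact (Nat.Prime 3)]
    (hK : Kato2004.charIdeal_dvd_padicLFunctionBranch_component_of_surjective)
    (hdivCyc : ∀ (κ : ZpExtension ℚ 3) (γ : Field.absoluteGaloisGroup ℚ), κ.IsCyclotomic →
      κ.IsTopGenerator γ → IsCyclotomicVariable 3 γ →
      ∀ D : W.SelmerDualData κ γ, Finite W.sha → Finite W.toAffine.Point →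
      ∀ g ∈ D.charIdeal,
        (3 : ℤ_[3]) ^ (padicValNat 3 (Nat.card (AddCommGroup.primaryComponent W.sha 3)) +
            padicValNat 3 (∏ᶠ v : HeightOneSpectrum (𝓞 ℚ),
              if ((3 : ℕ) : 𝓞 ℚ) ∈ v.asIdeal then 1 else W.tamagawaNumberAt v)) ∣
          PowerSeries.constantCoeff g * ((Nat.card W.toAffine.Point : ℕ) : ℤ_[3]) ^ 2)
    (hGZK : rank_eq_analyticRank_of_analyticRank_le_one) (hmod : hasEntireLFunction_rat)
    (hmodD : nonempty_modularParametrizationData)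
    (hX : ClassX4Gord W 3) (hr : W.analyticRank = 0) (hsurj : Surj W 3) :
    MissingUpperBoundAt W 3 :=
  ClassX4Gord.missingUpperBoundAt_three_of_chiBranch_of_surj_of_shaDvdCyc hdivCyc hGZK hmod hmodD
    (chiBranchLeadingTermOddBigImageAt_of_katoComponent W 3 hK
      (padicValRat_j_nonneg_of_typeGOrd W 3 hX.typeGOrd)) hX hr hsurj

/-- **`BSD(E,3)` on X4♯(G-ord) ∧ `p = 3` ∧ `r_an = 0` ∧ surj(3) from the LOWER half, on the
cyclotomic-generator supplier** — the tree's `ClassX4Gord.bsdp_three_of_katoComponent_of_surj_of_lower`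
with `hDel ↦ hdivCyc`. [cite: Kato2004Asterisque, Thm. 17.4 (3) (p. 273)]
[cite: Delbourgo1998, Prop. 4 (p. 144) (shape of the abstracted input only)] [cite: Miller2011LMS, §1 and Def. 1.1] -/
theorem ClassX4Gord.bsdp_three_of_katoComponent_of_surj_of_lower_of_shaDvdCyc [Fact (Nat.Prime 3)]
    (hK : Kato2004.charIdeal_dvd_padicLFunctionBranch_component_of_surjective)
    (hdivCyc : ∀ (κ : ZpExtension ℚ 3) (γ : Field.absoluteGaloisGroup ℚ), κ.IsCyclotomic →
      κ.IsTopGenerator γ → IsCyclotomicVariable 3 γ →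
      ∀ D : W.SelmerDualData κ γ, Finite W.sha → Finite W.toAffine.Point →
      ∀ g ∈ D.charIdeal,
        (3 : ℤ_[3]) ^ (padicValNat 3 (Nat.card (AddCommGroup.primaryComponent W.sha 3)) +
            padicValNat 3 (∏ᶠ v : HeightOneSpectrum (𝓞 ℚ),
              if ((3 : ℕ) : 𝓞 ℚ) ∈ v.asIdeal then 1 else W.tamagawaNumberAt v)) ∣
          PowerSeries.constantCoeff g * ((Nat.card W.toAffine.Point : ℕ) : ℤ_[3]) ^ 2)
    (hGZK : rank_eq_analyticRank_of_analyticRank_le_one) (hmod : hasEntireLFunction_rat)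
    (hmodD : nonempty_modularParametrizationData)
    (hX : ClassX4Gord W 3) (hr : W.analyticRank = 0) (hsurj : Surj W 3)
    (hlow : MissingLowerBoundAt W 3) : BSDp W 3 :=
  bsdp_of_missingPPartAt W 3 hGZK (by rw [hr]; exact zero_le_one)
    (missingPPartAt_of_lower_of_upper W 3 hlow
      (ClassX4Gord.missingUpperBoundAt_three_of_katoComponent_of_surj_of_shaDvdCyc hK hdivCyc hGZK hmod
        hmodD hX hr hsurj))

end Gord

end Summit.BirchSwinnertonDyer.Rank1Residual.Additive

end
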